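import Literature.Topology.FourManifolds.FlowsBoundaryTangent
import Literature.Geometry.Manifold.SubmersionLift
import Mathlib.Geometry.Manifold.PartitionOfUnity
import HarnessLib

/-!
# Lifting vectors through a map with surjective differential, tangentially to the boundary

Topic `Literature/Topology/FourManifolds` (infrastructure for Ehresmann-type product structures
on total spaces WITH boundary — Lefschetz fibrations over the disc with bounded fibres,
`Literature.Geometry.Symplectic.PALF` — whose trivialising flows must be flows of fields
**tangent to `∂W`**, `FlowsBoundaryTangent.lean`; fact seat
`provefact-Literature.Geometry.Symplectic.Oba2016_s-add47373d4`).  Everything is proved; no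
definitions, no named facts.

Bröcker–Jänich, *Introduction to Differential Topology* (1982), proof of (8.12) (PDF p. 57):
the basic fields of `ℝⁿ` lift through a submersion, locally by linear algebra and globally *"by
glueing together the locally chosen fields by means of a partition of unity"*; the tree has this
for manifolds WITHOUT boundary (`Literature.Geometry.Manifold.exists_contMDiff_lift_of_surjective_mfderiv`,
`SubmersionLift.lean`).  Here the version with boundary and with the lift tangent to it (Lee,
*Introduction to Smooth Manifolds* (2012), Thm. 9.34 needs exactly such fields; the boundary
condition is the linear-algebra form of "`f|∂W` is a submersion", as for the horizontal boundary
of a Lefschetz fibration):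

* §1 (any model with corners) `contMDiff_mfderiv_tangentBundle`, `contMDiffOn_mfderiv_section`
  — `x ↦ dg_x(s x)` is smooth for a smooth section `s`; `contMDiffOn_parallelSection`
  — the *parallel* local section `x ↦ tangentCoordChange I x₀ x x v` (constant coordinates `v` in
  the chart at `x₀`) is smooth on the chart source; `exists_local_lift_of_forall_mfderiv_eq` —
  given vectors `v i` at `x₀` with `dg_{x₀}(v i) = b i` for a basis `b` of the target, a smooth
  local lift `X = Σ aᵢ • (parallel vᵢ)` of any `c` (`dg_x(X x) = c` near `x₀`), the coefficients
  coming from the inverse of the smooth family `A(x) : b i ↦ dg_x(parallel vᵢ)`, `A(x₀) = id`;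
* §2 (half-space models `𝓡∂ (k + 1)`) at a boundary point with the `v i` tangent to `∂M`
  (`(v i) 0 = 0`) the local lift is tangent to `∂M` at every boundary point of its domain
  (`Literature.Topology.FourManifolds.tangentCoordChange_apply_zero_of_mem_boundary`), and the global theorem
  `exists_contMDiff_lift_tangent`: for `g : M → F` smooth, `C ⊆ M` closed, `dg_x` onto at the
  interior points of `C` and `dg_x|_{T∂M}` onto at the boundary points of `C`, and `c : F`, there
  is a smooth vector field `X` on `M`, tangent to `∂M` at every boundary point, with
  `dg_x(X x) = c` on `C` (the constraint sets are convex; Mathlib's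
  `exists_contMDiffSection_forall_mem_convex_of_local`).

## References

* Th. Bröcker, K. Jänich, *Introduction to Differential Topology*, CUP 1982, proof of (8.12)
  (PDF p. 57). [BrockerJanichIDT1982]
* J. M. Lee, *Introduction to Smooth Manifolds*, 2nd ed., GTM 218 (2012), Thm. 9.34, Prop. 8.23
  (fields tangent to `∂D`), Prop. 5.41 (`T∂M ⊂ TM`). [LeeSmoothManifolds2013]
-/

open scoped Manifold ContDiff Topology
open Set Function Filter Bundle

noncomputable section

namespace Literature.Topology.FourManifolds

universe u

/-! ### §1 Smooth local lifts through prescribed vectors (any model with corners) -/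

section General

variable {E : Type*} [NormedAddCommGroup E] [NormedSpace ℝ E]
  {H : Type*} [TopologicalSpace H] {I : ModelWithCorners ℝ E H}
  {M : Type*} [TopologicalSpace M] [ChartedSpace H M] [IsManifold I ∞ M]
  {F : Type*} [NormedAddCommGroup F] [NormedSpace ℝ F]

/-- The pairing `(x, v) ↦ dg_x(v)` is a smooth map on the tangent bundle of `M` when `g : M → F`
is smooth into a normed space (it is the second component of the tangent map
`Tg : TM → TF = F × F`). [folklore] -/
theorem contMDiff_mfderiv_tangentBundle {g : M → F} (hg : ContMDiff I 𝓘(ℝ, F) ∞ g) :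
    ContMDiff I.tangent 𝓘(ℝ, F) ∞
      (fun p : TangentBundle I M => mfderiv I 𝓘(ℝ, F) g p.proj p.2) :=
  (contMDiff_snd_tangentBundle_modelSpace F 𝓘(ℝ, F)).comp (hg.contMDiff_tangentMap le_rfl)

/-- `x ↦ dg_x(s x)` is smooth on `u` for a vector field `s` smooth on `u`. [folklore] -/
theorem contMDiffOn_mfderiv_section {g : M → F} (hg : ContMDiff I 𝓘(ℝ, F) ∞ g)
    {s : Π x : M, TangentSpace I x} {u : Set M}
    (hs : ContMDiffOn I I.tangent ∞ (fun x => (⟨x, s x⟩ : TangentBundle I M)) u) :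
    ContMDiffOn I 𝓘(ℝ, F) ∞ (fun x => mfderiv I 𝓘(ℝ, F) g x (s x)) u :=
  (contMDiff_mfderiv_tangentBundle hg).comp_contMDiffOn hs

/-- **Parallel local sections are smooth.**  For `v : E` the vector field
`x ↦ tangentCoordChange I x₀ x x v` — the tangent vector at `x` whose coordinates in the chart at
`x₀` are `v` (Milnor's local fields "`∂/∂x₁` with coordinates `(1, 0, …, 0)` on `Uᵢ`" in the
proof of Lemma 3.2 of the h-cobordism lectures) — is smooth on the source of the chart at `x₀`:
in the trivialisation of `TM` at `x₀` it reads constantly `v`. [folklore] -/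
theorem contMDiffOn_parallelSection (x₀ : M) (v : E) :
    ContMDiffOn I I.tangent ∞
      (fun x => (⟨x, tangentCoordChange I x₀ x x v⟩ : TangentBundle I M)) (chartAt H x₀).source := by
  set e := trivializationAt E (TangentSpace I : M → Type _) x₀ with he
  have hbase : e.baseSet = (chartAt H x₀).source := rfl
  rw [← hbase, e.contMDiffOn_section_baseSet_iff]
  apply (contMDiffOn_const (c := v)).congr
  intro x hx
  have hx' : x ∈ (extChartAt I x₀).source := by rwa [extChartAt_source]
  change tangentCoordChange I x x₀ x (tangentCoordChange I x₀ x x v) = v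
  rw [tangentCoordChange_comp ⟨⟨hx', mem_extChartAt_source x⟩, hx'⟩, tangentCoordChange_self hx']

/-- The parallel section through `v` passes through `v` at `x₀`. [folklore] -/
theorem parallelSection_self (x₀ : M) (v : E) :
    tangentCoordChange I x₀ x₀ x₀ v = v :=
  tangentCoordChange_self (mem_extChartAt_source x₀)

variable [FiniteDimensional ℝ F]

/-- **Local lifts through prescribed vectors** (Bröcker–Jänich 1982, proof of (8.12): "Locally,
about a point `x ∈ E`, such fields are easy to find").  Let `g : M → F` be smooth (`F`
finite-dimensional with basis `b`), and at `x₀` let vectors `v i` be given with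
`dg_{x₀}(v i) = b i`.  Then for every `c : F` there are an open `U ∋ x₀` inside the chart source
and smooth coefficient functions `a i` on `U` such that the field
`X x = Σ i, a i x • tangentCoordChange I x₀ x x (v i)` — a combination of the parallel sections
through the `v i` — satisfies `dg_x(X x) = c` on `U`.  Construction: the smooth family of
endomorphisms `A(x) = Σ i, (b.coord i) ⊗ dg_x(parallel vᵢ)` of `F` is the identity at `x₀`,
hence invertible near `x₀`, and `a x = b.repr (A(x)⁻¹ c)`. [cite: BrockerJanichIDT1982, (8.12) (proof, local lifts)] -/
theorem exists_local_lift_of_forall_mfderiv_eq {g : M → F} (hg : ContMDiff I 𝓘(ℝ, F) ∞ g)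
    {ι : Type*} [Fintype ι] (b : Module.Basis ι ℝ F) {x₀ : M} (v : ι → E)
    (hv : ∀ i, mfderiv I 𝓘(ℝ, F) g x₀ (v i) = b i) (c : F) :
    ∃ U : Set M, IsOpen U ∧ x₀ ∈ U ∧ U ⊆ (chartAt H x₀).source ∧ ∃ a : ι → M → ℝ,
      (∀ i, ContMDiffOn I 𝓘(ℝ, ℝ) ∞ (a i) U) ∧
      ∀ x ∈ U, mfderiv I 𝓘(ℝ, F) g x (∑ i, a i x • tangentCoordChange I x₀ x x (v i)) = c := by
  classical
  -- the parallel sections and their images under `dg`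
  set s : ι → Π x : M, TangentSpace I x := fun i x => tangentCoordChange I x₀ x x (v i) with hs
  have hss : ∀ i, ContMDiffOn I I.tangent ∞ (fun x => (⟨x, s i x⟩ : TangentBundle I M))
      (chartAt H x₀).source := fun i => contMDiffOn_parallelSection x₀ (v i)
  set w : ι → M → F := fun i x => mfderiv I 𝓘(ℝ, F) g x (s i x) with hw
  have hws : ∀ i, ContMDiffOn I 𝓘(ℝ, F) ∞ (w i) (chartAt H x₀).source := fun i =>
    contMDiffOn_mfderiv_section hg (hss i)
  have hw₀ : ∀ i, w i x₀ = b i := fun i => by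
    simp only [hw, hs, parallelSection_self]; exact hv i
  -- the family of endomorphisms `A x`
  set ℓ : ι → F →L[ℝ] ℝ := fun i => LinearMap.toContinuousLinearMap (b.coord i) with hℓ
  set A : M → F →L[ℝ] F := fun x => ∑ i, ContinuousLinearMap.smulRightL ℝ F F (ℓ i) (w i x)
    with hA
  have hA_apply : ∀ x u, A x u = ∑ i, (b.coord i u) • w i x := fun x u => by
    rw [hA, sum_apply]
    rfl
  have hAs : ContMDiffOn I 𝓘(ℝ, F →L[ℝ] F) ∞ A (chartAt H x₀).source := by
    refine contMDiffOn_finsetSum fun i _ => ?_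
    exact (ContinuousLinearMap.smulRightL ℝ F F (ℓ i)).contMDiff.comp_contMDiffOn (hws i)
  have hA₀ : A x₀ = 1 := by
    ext u
    change A x₀ u = u
    rw [hA_apply]
    simp only [hw₀, Module.Basis.coord_apply]
    exact b.sum_repr u
  -- invertible near `x₀`
  set O : Set M := (chartAt H x₀).source ∩ A ⁻¹' {f | IsUnit f} with hO
  have hOo : IsOpen O :=
    hAs.continuousOn.isOpen_inter_preimage (chartAt H x₀).open_source Units.isOpen
  have hx₀O : x₀ ∈ O :=
    ⟨mem_chart_source H x₀, by rw [mem_preimage, mem_setOf_eq, hA₀]; exact isUnit_one⟩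
  have hAinv : ∀ x ∈ O, (A x).IsInvertible := fun x hx =>
    Literature.Analysis.ODE.isInvertible_of_isUnit hx.2
  -- the coefficients
  have hinv : ContMDiffOn I 𝓘(ℝ, F →L[ℝ] F) ∞ (fun x => (A x).inverse) O := fun x hx =>
    ((hAinv x hx).contDiffAt_map_inverse (n := ∞)).comp_contMDiffWithinAt
      ((hAs x hx.1).mono inter_subset_left)
  have hinvc : ContMDiffOn I 𝓘(ℝ, F) ∞ (fun x => (A x).inverse c) O :=
    hinv.clm_apply contMDiffOn_const
  refine ⟨O, hOo, hx₀O, inter_subset_left, fun i x => b.coord i ((A x).inverse c),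
    fun i => ?_, fun x hx => ?_⟩
  · exact ((ℓ i).contMDiff.comp_contMDiffOn hinvc).congr fun x _ => rfl
  · have h1 : mfderiv I 𝓘(ℝ, F) g x (∑ i, b.coord i ((A x).inverse c) • s i x) =
        ∑ i, b.coord i ((A x).inverse c) • w i x := by
      rw [map_sum]
      refine Finset.sum_congr rfl fun i _ => ?_
      rw [map_smul]
      rfl
    show mfderiv I 𝓘(ℝ, F) g x (∑ i, b.coord i ((A x).inverse c) • s i x) = c
    rw [h1, ← hA_apply, Literature.Geometry.Manifold.apply_inverse_of_isInvertible (hAinv x hx) c]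

end General

/-! ### §2 Half-space models: lifts tangent to the boundary -/

section Boundary

variable {k : ℕ} {M : Type u} [TopologicalSpace M] [ChartedSpace (EuclideanHalfSpace (k + 1)) M]
  [IsManifold (𝓡∂ (k + 1)) ∞ M]
  {F : Type*} [NormedAddCommGroup F] [NormedSpace ℝ F]

/-- A combination of parallel sections through boundary-tangent vectors at a boundary point is
tangent to the boundary at every boundary point of the chart source (coordinate changes
preserve the boundary tangent hyperplane, `Literature.Topology.FourManifolds.tangentCoordChange_apply_zero_of_mem_boundary`).
[cite: LeeSmoothManifolds2013, Prop. 5.41 and Prop. 8.23] -/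
theorem halfSpaceCoord_sum_smul_parallelSection_eq_zero {ι : Type*} [Fintype ι] {x₀ : M}
    (hx₀ : x₀ ∈ (𝓡∂ (k + 1)).boundary M) {v : ι → EuclideanSpace ℝ (Fin (k + 1))}
    (hv : ∀ i, v i 0 = 0) (a : ι → ℝ) {x : M} (hx : x ∈ (chartAt (EuclideanHalfSpace (k + 1)) x₀).source)
    (hxb : x ∈ (𝓡∂ (k + 1)).boundary M) :
    halfSpaceCoord k (∑ i, a i • tangentCoordChange (𝓡∂ (k + 1)) x₀ x x (v i)) = 0 := by
  have hx' : x ∈ (extChartAt (𝓡∂ (k + 1)) x₀).source := by rwa [extChartAt_source]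
  have _ := hx₀
  rw [map_sum]
  refine Finset.sum_eq_zero fun i _ => ?_
  rw [map_smul, halfSpaceCoord_apply,
    tangentCoordChange_apply_zero_of_mem_boundary ⟨hx', mem_extChartAt_source x⟩ hxb (hv i),
    smul_zero]

omit [IsManifold (𝓡∂ (k + 1)) ∞ M] in
/-- The constraint set of the gluing: tangent to `∂M` at boundary points, lifting `c` on `C`;
it is convex. [folklore] -/
theorem convex_liftConstraint (g : M → F) (C : Set M) (c : F) (x : M) :
    Convex ℝ {v : TangentSpace (𝓡∂ (k + 1)) x |
      (x ∈ (𝓡∂ (k + 1)).boundary M → halfSpaceCoord k v = 0) ∧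
      (x ∈ C → mfderiv (𝓡∂ (k + 1)) 𝓘(ℝ, F) g x v = c)} := by
  intro u hu w hw p q _ _ hpq
  refine ⟨fun hxb => ?_, fun hxC => ?_⟩
  · -- `halfSpaceCoord` read on the tangent space (the same map; the tangent space is the
    -- model space by definition)
    set L : TangentSpace (𝓡∂ (k + 1)) x →L[ℝ] ℝ := halfSpaceCoord k with hL
    have h1 : L u = 0 := hu.1 hxb
    have h2 : L w = 0 := hw.1 hxb
    change L (p • u + q • w) = 0
    rw [map_add, map_smul, map_smul, h1, h2, smul_zero, smul_zero, add_zero]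
  · have h1 := hu.2 hxC
    have h2 := hw.2 hxC
    rw [map_add, map_smul, map_smul, h1, h2, ← add_smul, hpq, one_smul]

variable [FiniteDimensional ℝ F] [T2Space M] [SigmaCompactSpace M]

/-- **Lifting a vector through a map with surjective differential, tangentially to the
boundary** (Bröcker–Jänich 1982, proof of (8.12), for manifolds with boundary; Lee 2012,
Thm. 9.34 / Prop. 8.23 for the rôle of tangency).  Let `M` be a `σ`-compact Hausdorff manifold
with boundary (model `𝓡∂ (k + 1)`), `g : M → F` smooth into a finite-dimensional space,
`C ⊆ M` closed, and suppose that `dg_x` is onto at every interior point `x ∈ C` and that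
`dg_x` restricted to the boundary tangent hyperplane `{v | v 0 = 0}` is onto at every boundary
point `x ∈ C`.  Then for every `c : F` there is a smooth vector field `X` on `M` which is
**tangent to `∂M` at every boundary point** (`(X z) 0 = 0`) and satisfies `dg_x(X x) = c` for
all `x ∈ C`.  (Local lifts: zero off `C`; `exists_local_lift_of_forall_mfderiv_eq` through
arbitrary preimages of a basis at interior points of `C`, restricted to the interior, and
through boundary-tangent preimages at boundary points of `C`, tangent along the boundary by
`halfSpaceCoord_sum_smul_parallelSection_eq_zero`; glued by a smooth partition of unity over
the convex constraint sets.) [cite: BrockerJanichIDT1982, (8.12) (proof, lifting the basic fields)]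
[cite: LeeSmoothManifolds2013, Thm. 9.34] -/
theorem exists_contMDiff_lift_tangent {g : M → F} (hg : ContMDiff (𝓡∂ (k + 1)) 𝓘(ℝ, F) ∞ g)
    {C : Set M} (hC : IsClosed C)
    (hint : ∀ x ∈ C, (𝓡∂ (k + 1)).IsInteriorPoint x →
      Surjective (mfderiv (𝓡∂ (k + 1)) 𝓘(ℝ, F) g x))
    (hbdry : ∀ x ∈ C, x ∈ (𝓡∂ (k + 1)).boundary M → ∀ w : F,
      ∃ v : EuclideanSpace ℝ (Fin (k + 1)), v 0 = 0 ∧ mfderiv (𝓡∂ (k + 1)) 𝓘(ℝ, F) g x v = w)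
    (c : F) :
    ∃ X : Π x : M, TangentSpace (𝓡∂ (k + 1)) x,
      ContMDiff (𝓡∂ (k + 1)) (𝓡∂ (k + 1)).tangent ∞
        (fun x => (⟨x, X x⟩ : TangentBundle (𝓡∂ (k + 1)) M)) ∧
      (∀ z ∈ (𝓡∂ (k + 1)).boundary M, halfSpaceCoord k (X z) = 0) ∧
      ∀ x ∈ C, mfderiv (𝓡∂ (k + 1)) 𝓘(ℝ, F) g x (X x) = c := by
  classical
  set b := Module.finBasis ℝ F with hb
  set t : ∀ x : M, Set (TangentSpace (𝓡∂ (k + 1)) x) := fun x =>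
    {v | (x ∈ (𝓡∂ (k + 1)).boundary M → halfSpaceCoord k v = 0) ∧
      (x ∈ C → mfderiv (𝓡∂ (k + 1)) 𝓘(ℝ, F) g x v = c)} with ht
  have hloc : ∀ x₀ : M, ∃ U ∈ 𝓝 x₀, ∃ X : Π x : M, TangentSpace (𝓡∂ (k + 1)) x,
      ContMDiffOn (𝓡∂ (k + 1)) ((𝓡∂ (k + 1)).prod 𝓘(ℝ, EuclideanSpace ℝ (Fin (k + 1)))) ∞
        (fun x => TotalSpace.mk' (EuclideanSpace ℝ (Fin (k + 1))) x (X x)) U ∧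
      ∀ y ∈ U, X y ∈ t y := by
    intro x₀
    by_cases hx₀C : x₀ ∈ C
    · by_cases hx₀b : x₀ ∈ (𝓡∂ (k + 1)).boundary M
      · -- boundary point of `C`: boundary-tangent preimages of the basis
        choose v hv0 hv using fun i => hbdry x₀ hx₀C hx₀b (b i)
        obtain ⟨U, hUo, hx₀U, hUsub, a, ha, hlift⟩ :=
          exists_local_lift_of_forall_mfderiv_eq hg b v hv c
        refine ⟨U, hUo.mem_nhds hx₀U, fun x => ∑ i, a i x • tangentCoordChange (𝓡∂ (k + 1)) x₀ x x (v i),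
          ?_, fun y hy => ⟨fun hyb => ?_, fun _ => hlift y hy⟩⟩
        · exact ContMDiffOn.sum_section fun i _ =>
            (ha i).smul_section ((contMDiffOn_parallelSection x₀ (v i)).mono hUsub)
        · exact halfSpaceCoord_sum_smul_parallelSection_eq_zero hx₀b hv0 _ (hUsub hy) hyb
      · -- interior point of `C`: any preimages of the basis, restricted to the interior
        have hx₀i : (𝓡∂ (k + 1)).IsInteriorPoint x₀ := by
          by_contra h
          exact hx₀b (((𝓡∂ (k + 1)).isBoundaryPoint_iff_not_isInteriorPoint x₀).2 h)
        have hint' : ∀ w : F, ∃ v : EuclideanSpace ℝ (Fin (k + 1)),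
            mfderiv (𝓡∂ (k + 1)) 𝓘(ℝ, F) g x₀ v = w := fun w => hint x₀ hx₀C hx₀i w
        choose v hv using fun i => hint' (b i)
        obtain ⟨U, hUo, hx₀U, hUsub, a, ha, hlift⟩ :=
          exists_local_lift_of_forall_mfderiv_eq hg b v hv c
        refine ⟨U ∩ (𝓡∂ (k + 1)).interior M,
          (hUo.inter (ModelWithCorners.isOpen_interior (I := 𝓡∂ (k + 1)) (M := M) (n := ∞)
            (by simp))).mem_nhds ⟨hx₀U, hx₀i⟩,
          fun x => ∑ i, a i x • tangentCoordChange (𝓡∂ (k + 1)) x₀ x x (v i),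
          ?_, fun y hy => ⟨fun hyb => ?_, fun _ => hlift y hy.1⟩⟩
        · exact (ContMDiffOn.sum_section fun i _ =>
            (ha i).smul_section ((contMDiffOn_parallelSection x₀ (v i)).mono hUsub)).mono
            inter_subset_left
        · exact absurd hy.2 (((𝓡∂ (k + 1)).isBoundaryPoint_iff_not_isInteriorPoint y).1 hyb)
    · -- off `C`: the zero field
      refine ⟨Cᶜ, hC.isOpen_compl.mem_nhds hx₀C, fun _ => 0, ?_, fun y hy => ⟨fun _ => map_zero _,
        fun hyC => absurd hyC hy⟩⟩
      exact (contMDiff_zeroSection ℝ (TangentSpace (𝓡∂ (k + 1)) : M → Type _)).contMDiffOn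
  obtain ⟨s, hs⟩ := exists_contMDiffSection_forall_mem_convex_of_local (n := (⊤ : ℕ∞)) (𝓡∂ (k + 1))
    (fun x => TangentSpace (𝓡∂ (k + 1)) x) t (fun x => convex_liftConstraint g C c x) hloc
  exact ⟨s, s.contMDiff, fun z hz => (hs z).1 hz, fun x hx => (hs x).2 hx⟩

end Boundary

end Literature.Topology.FourManifolds
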